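import Mathlib
import HarnessLib
import Literature.MathematicalPhysics.KineticTheory.VelocityFlipNoise
import Summits.AtomisticToContinuum.FouriersLaw.Theorems.JunctionLocalitySuperadditiveResistanceKuboPlain
import Summits.AtomisticToContinuum.FouriersLaw.Theorems.JunctionLocalityConductanceLowerBoundStubRowSum
import Summits.AtomisticToContinuum.FouriersLaw.Theorems.VanishingNoiseTransferVanishingNoiseBoundFlipKuboDirichlet

/-!
# The flip-noisy chain's Kubo conductance is an Onsager quantity: `0 < G_L(ε) ≤ γ`, and its energy row sum

`--supports stmt-AtomisticToContinuum-11976` helper file (crux `VanishingNoiseBound`, route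
`VanishingNoiseTransfer`, line `fekete-usc-one-length`, stub S3 `stub_noisyPositiveConductance`, wave 3).
The SIGN half of the finite-volume Green–Kubo formula for the velocity-flip chain, in forward-field form.

Setting: the pinned anharmonic chain `pinnedChain ω₂ lam β γ` (all parameters `> 0`), `T > 0`, `L ≥ 2`,
a flip rate `ε ≥ 0`, and a classical FORWARD FIELD of the LEFT bath for the flip-noisy equilibrium generator
`L_{T,T} + εS` (`OscillatorChain.flipGenerator`, `S = flipNoise` = Bernardin–Olla's velocity flips at every
site): `g ∈ C² ∩ L²(μ_T)` with `(L_{T,T} + εS) g = −(p_0² − T)` pointwise. Write `k_b = p_b² − T`,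
`A = ⟨g, k_0⟩_{μ_T}`, `B = ⟨g, k_{L−1}⟩_{μ_T}` and `G = γ(1 − (γ/T²) A)` (the Kubo conductance; by the
mixing-free Kubo link it is `D_L/(L−1)` along the unique flip-steady family).

* `flipKubo_pos_and_le` — **`0 < G ≤ γ`**: `g` is an `ε = 0` forward PAIR for the modified source
  `k' = k_0 + εSg` (`flip_forwardPair`, companion file `…FlipKuboDirichlet.lean`), so fluctuation–dissipation reads
  `A = γT(‖∂_{p_0}g‖² + ‖∂_{p_{L−1}}g‖²) + ε·½Σ_i‖g∘F_i − g‖² ≥ 0`; the Gaussian integration by parts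
  `A = T⟨p_0, ∂_{p_0} g⟩` and `2 p ∂g ≤ p²/γ + γ (∂g)²` give `A ≤ T²/γ − γT‖∂_{p_{L−1}}g‖² − (ε/2)Σ_i‖g∘F_i − g‖²`;
  strictness: either the flip Dirichlet energy is `> 0`, or `g` is flip invariant, `S g ≡ 0`, `g` is a plain
  forward field and `plainKubo_pos` (kernel of the Onsager Laplacian = constants, crux 11748) applies.
* `helper_flipKuboPositive` — registered helper (notation-free restatement, bundled with the row sum
  `flip_rowSum` of the companion file).

References: Bonetto–Lebowitz–Rey-Bellet 2000, eq. (32); Rey-Bellet 2003, Rem. 4.4; Bernardin–Olla 2011 §2.1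
(`S` symmetric, non-positive); Eckmann–Pillet–Rey-Bellet 1999 §3; folklore (second law at linear response).
-/

noncomputable section

open MeasureTheory Filter Topology
open scoped ContDiff
open Literature.MathematicalPhysics.KineticTheory.HeatConduction
open Summit.AtomisticToContinuum.FouriersLaw.Theorems.SuperadditiveResistance.DeviceLiouville
  (kin kin_eq_sq liouvilleOp bathOp)
open Summit.AtomisticToContinuum.FouriersLaw.Theorems.SuperadditiveResistance.Kubo
  (termWeight termWeight_nonneg termWeight_pos sum_termWeight_mul memLp_partialP fluctuation_dissipation
    memLp_kinetic memLp_hamiltonian partition_pos integrable_mul_gibbsDensity_iff integrable_mul_mul_gibbsDensity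
    integrable_sq_mul_gibbsDensity)
open Summit.AtomisticToContinuum.FouriersLaw.Theorems.SuperadditiveResistance.KuboPlain
  (plainForwardFields plainKubo plainKubo_pos generator_eq_liouvilleOp_add_bathOp bathFin bathFin_zero bathFin_one
    bathFin_injective bathWeight_eq_termWeight)
open Summit.AtomisticToContinuum.FouriersLaw.Cruxes.SuperadditiveResistance.FloatingProbeBypassLaplacian
  (pinnedChain_memLp_two_snd pinnedChain_memLp_two_snd_sq pinnedChain_integral_snd_sq
    integral_mul_sq_sub_gibbsMeasure)
open Summit.AtomisticToContinuum.FouriersLaw.Cruxes.ConductanceLowerBound.ForecastSensitivity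
  (integral_cross_eq liouvilleOp_hamiltonian bathOp_bathWeight_hamiltonian)

namespace Summit.AtomisticToContinuum.FouriersLaw.Theorems.VanishingNoiseBound

/-! ## Positivity and the trivial upper bound of the flip-noisy Kubo conductance -/

section Positivity

variable {ω₂ lam β γ : ℝ}

/-- The generator kills additive constants. [folklore] -/
theorem generator_sub_const (P : OscillatorChain) (L : ℕ) (T_L T_R : ℝ) (g : PhaseSpace L → ℝ) (m : ℝ)
    (x : PhaseSpace L) : P.generator L T_L T_R (fun y => g y - m) x = P.generator L T_L T_R g x := by
  have hP : ∀ (i : Fin L) (f : PhaseSpace L → ℝ) (y : PhaseSpace L),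
      partialP i (fun z => f z - m) y = partialP i f y := by
    intro i f y
    simp only [partialP]
    rw [deriv_sub_const]
  have hQ : ∀ (i : Fin L) (y : PhaseSpace L), partialQ i (fun z => g z - m) y = partialQ i g y := by
    intro i y
    simp only [partialQ]
    rw [deriv_sub_const]
  have hPP : ∀ (i : Fin L) (y : PhaseSpace L),
      partialP i (partialP i (fun z => g z - m)) y = partialP i (partialP i g) y := by
    intro i y
    have : partialP i (fun z => g z - m) = partialP i g := funext fun z => hP i g z
    rw [this]
  simp only [OscillatorChain.generator, hP, hQ, hPP]

/-- The flip noise kills additive constants. [folklore] -/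
theorem flipNoise_sub_const (L : ℕ) (g : PhaseSpace L → ℝ) (m : ℝ) (x : PhaseSpace L) :
    flipNoise L (fun y => g y - m) x = flipNoise L g x := by
  simp [flipNoise]

/-- **`0 < G_L(ε) ≤ γ` — the flip-noisy chain's Kubo conductance is positive and at most `γ`.** For
`pinnedChain ω₂ lam β γ` (all `> 0`), `T > 0`, `L ≥ 2`, `ε ≥ 0` and every classical `C² ∩ L²(μ_T)` solution `g` of
`(L_{T,T} + εS) g = −(p_0² − T)`: with `A = ∫ g (p_0² − T) dμ_T`, `0 < γ(1 − (γ/T²)A) ≤ γ`. -/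
theorem flipKubo_pos_and_le (hω : 0 < ω₂) (hl : 0 < lam) (hβ : 0 < β) (hγ : 0 < γ) {T : ℝ} (hT : 0 < T)
    {ε : ℝ} (hε : 0 ≤ ε) {L : ℕ} (hL : 2 ≤ L) {g : PhaseSpace L → ℝ} (hg2 : ContDiff ℝ 2 g)
    (hgL : MemLp g 2 ((pinnedChain ω₂ lam β γ).gibbsMeasure L T))
    (hpde : ∀ x, (pinnedChain ω₂ lam β γ).flipGenerator L T T ε g x = -(kin L 0 x - T)) :
    0 < γ * (1 - γ / T ^ 2 * ∫ x, g x * (kin L 0 x - T) ∂((pinnedChain ω₂ lam β γ).gibbsMeasure L T)) ∧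
      γ * (1 - γ / T ^ 2 * ∫ x, g x * (kin L 0 x - T) ∂((pinnedChain ω₂ lam β γ).gibbsMeasure L T)) ≤ γ := by
  have hL1 : 1 ≤ L := by omega
  have hL0 : 0 < L := by omega
  set μ := (pinnedChain ω₂ lam β γ).gibbsMeasure L T with hμ
  haveI : IsProbabilityMeasure μ := pinnedChain_isProbabilityMeasure_gibbsMeasure hω hl.le hβ.le γ L hT
  have hflip := gibbs_flipInvariant (ω₂ := ω₂) (lam := lam) (β := β) (γ := γ) L T
  set i0 : Fin L := ⟨0, hL0⟩ with hi0
  set i1 : Fin L := ⟨L - 1, by omega⟩ with hi1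
  set s := bathFin L hL1 with hs_def
  have hs : Function.Injective s := bathFin_injective hL
  have hs0 : s 0 = i0 := bathFin_zero hL1
  have hs1 : s 1 = i1 := bathFin_one hL1
  have hBw : OscillatorChain.bathWeight L = termWeight s := bathWeight_eq_termWeight hL
  have hkin : ∀ x : PhaseSpace L, kin L 0 x = x.2 i0 ^ 2 := fun x => kin_eq_sq hL0 x
  -- the modified source `k' = k_0 + ε S g`
  set k' : PhaseSpace L → ℝ := fun x => (x.2 i0 ^ 2 - T) + ε * flipNoise L g x with hk'
  have hpair : ∀ x, (1 : ℝ) * liouvilleOp (pinnedChain ω₂ lam β γ) L g x + γ * bathOp L (termWeight s) T g x = -k' x := by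
    intro x
    rw [← hBw]
    have h := flip_forwardPair (ω₂ := ω₂) (lam := lam) (β := β) (γ := γ) L T ε
      (k := fun y => kin L 0 y - T) hpde x
    rw [h, hk', hkin x]
  have hk0L2 : MemLp (fun x : PhaseSpace L => x.2 i0 ^ 2 - T) 2 μ := memLp_kinetic (γ := γ) hω hl.le hβ.le L hT i0
  have hSgL2 : MemLp (flipNoise L g) 2 μ := memLp_flipNoise hflip hgL
  have hk'L2 : MemLp k' 2 μ := hk0L2.add (hSgL2.const_mul ε)
  have hB0 : ∀ i, 0 ≤ termWeight s i := termWeight_nonneg s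
  -- finite entropy production at the two contacts
  have hd0 : MemLp (partialP i0 g) 2 μ := by
    have h := memLp_partialP hω hl.le hβ.le γ L hT (termWeight s) hB0 1 hγ hg2 hgL hk'L2 hpair
      (i := s 0) (termWeight_pos s hs 0)
    rwa [hs0] at h
  have hd1 : MemLp (partialP i1 g) 2 μ := by
    have h := memLp_partialP hω hl.le hβ.le γ L hT (termWeight s) hB0 1 hγ hg2 hgL hk'L2 hpair
      (i := s 1) (termWeight_pos s hs 1)
    rwa [hs1] at h
  -- fluctuation–dissipation in `μ_T` form: `∫ g k' dμ = γT(‖∂_0 g‖² + ‖∂_1 g‖²)`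
  have hZ : 0 < ∫ x, (pinnedChain ω₂ lam β γ).gibbsDensity L T x := partition_pos hω hl.le hβ.le L hT
  set D0 : ℝ := ∫ x, partialP i0 g x ^ 2 ∂μ with hD0
  set D1 : ℝ := ∫ x, partialP i1 g x ^ 2 ∂μ with hD1
  have hD0n : 0 ≤ D0 := integral_nonneg fun x => sq_nonneg _
  have hD1n : 0 ≤ D1 := integral_nonneg fun x => sq_nonneg _
  have hFD : ∫ x, g x * k' x ∂μ = γ * T * (D0 + D1) := by
    have h := fluctuation_dissipation hω hl.le hβ.le L hT (termWeight s) hB0 1 hγ hg2 hgL hk'L2 hpair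
    rw [sum_termWeight_mul s, Fin.sum_univ_two, hs0, hs1] at h
    rw [(pinnedChain ω₂ lam β γ).integral_gibbsMeasure, h, hD0, hD1, (pinnedChain ω₂ lam β γ).integral_gibbsMeasure, (pinnedChain ω₂ lam β γ).integral_gibbsMeasure]
    field_simp
  -- the flip Dirichlet energy
  set E : ℝ := ∑ i, ∫ x, (g (momentumFlip i x) - g x) ^ 2 ∂μ with hE
  have hEn : 0 ≤ E := flipDirichlet_nonneg g
  have hgS : ∫ x, g x * flipNoise L g x ∂μ = -(1 / 2) * E := integral_mul_flipNoise_self hflip hgL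
  -- `A = γT(D0 + D1) + (ε/2) E`
  set A : ℝ := ∫ x, g x * (kin L 0 x - T) ∂μ with hA
  have hAeq : A = γ * T * (D0 + D1) + ε / 2 * E := by
    have i1 : Integrable (fun x => g x * (x.2 i0 ^ 2 - T)) μ := hgL.integrable_mul hk0L2
    have i2 : Integrable (fun x => g x * flipNoise L g x) μ := hgL.integrable_mul hSgL2
    have e : (fun x => g x * k' x) = fun x => g x * (x.2 i0 ^ 2 - T) + ε * (g x * flipNoise L g x) := by
      funext x; rw [hk']; ring
    have hA' : A = ∫ x, g x * (x.2 i0 ^ 2 - T) ∂μ := by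
      rw [hA]; exact integral_congr_ae (ae_of_all _ fun x => by dsimp only; rw [hkin x])
    rw [e, integral_add i1 (i2.const_mul ε), integral_const_mul, hgS] at hFD
    rw [hA']
    linarith
  -- Gaussian integration by parts and `2 p ∂g ≤ p²/γ + γ(∂g)²`
  have hgd : Differentiable ℝ g := hg2.differentiable (by norm_num)
  have hIBP : ∫ x, g x * (x.2 i0 ^ 2 - T) ∂μ = T * ∫ x, partialP i0 g x * x.2 i0 ∂μ :=
    integral_mul_sq_sub_gibbsMeasure hω hl.le hβ.le γ L hT i0 hgd hgL hd0
  have hp2 : ∫ x, x.2 i0 ^ 2 ∂μ = T := pinnedChain_integral_snd_sq hω hl.le hβ.le γ L hT i0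
  have hpL2 : MemLp (fun x : PhaseSpace L => x.2 i0) 2 μ := pinnedChain_memLp_two_snd hω hl.le hβ.le γ L hT i0
  have hAMGM : ∫ x, partialP i0 g x * x.2 i0 ∂μ ≤ T / (2 * γ) + γ / 2 * D0 := by
    have i1 : Integrable (fun x => partialP i0 g x * x.2 i0) μ := hd0.integrable_mul hpL2
    have i2 : Integrable (fun x : PhaseSpace L => x.2 i0 ^ 2) μ := hpL2.integrable_sq
    have i3 : Integrable (fun x => partialP i0 g x ^ 2) μ := hd0.integrable_sq
    have hle : ∀ x, partialP i0 g x * x.2 i0 ≤ (1 / (2 * γ)) * x.2 i0 ^ 2 + γ / 2 * partialP i0 g x ^ 2 := by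
      intro x
      have h : 0 ≤ (x.2 i0 / γ - partialP i0 g x) ^ 2 := sq_nonneg _
      have e : (1 / (2 * γ)) * x.2 i0 ^ 2 + γ / 2 * partialP i0 g x ^ 2 - partialP i0 g x * x.2 i0 =
          γ / 2 * (x.2 i0 / γ - partialP i0 g x) ^ 2 := by field_simp; ring
      nlinarith
    have i2' : Integrable (fun x : PhaseSpace L => (1 / (2 * γ)) * x.2 i0 ^ 2) μ := i2.const_mul (1 / (2 * γ))
    have i3' : Integrable (fun x => γ / 2 * partialP i0 g x ^ 2) μ := i3.const_mul (γ / 2)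
    have i23 : Integrable (fun x => (1 / (2 * γ)) * x.2 i0 ^ 2 + γ / 2 * partialP i0 g x ^ 2) μ := i2'.add i3'
    calc ∫ x, partialP i0 g x * x.2 i0 ∂μ
        ≤ ∫ x, (1 / (2 * γ)) * x.2 i0 ^ 2 + γ / 2 * partialP i0 g x ^ 2 ∂μ := integral_mono i1 i23 hle
      _ = (1 / (2 * γ)) * T + γ / 2 * D0 := by
          rw [integral_add i2' i3', integral_const_mul, integral_const_mul, hp2]
      _ = T / (2 * γ) + γ / 2 * D0 := by ring
  -- hence `A ≤ T²/γ − γT·D1 − (ε/2)E`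
  have hA' : A = T * ∫ x, partialP i0 g x * x.2 i0 ∂μ := by
    rw [hA, ← hIBP]; exact integral_congr_ae (ae_of_all _ fun x => by dsimp only; rw [hkin x])
  have hAle : A ≤ T ^ 2 / γ - γ * T * D1 - ε / 2 * E := by
    have h1 : A ≤ T * (T / (2 * γ) + γ / 2 * D0) := by
      rw [hA']; exact mul_le_mul_of_nonneg_left hAMGM hT.le
    have h2 : γ * T * D0 = A - γ * T * D1 - ε / 2 * E := by linarith
    have h3 : T * (T / (2 * γ) + γ / 2 * D0) = T ^ 2 / (2 * γ) + (γ * T * D0) / 2 := by field_simp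
    rw [h3, h2] at h1
    have : A ≤ T ^ 2 / γ - γ * T * D1 - ε / 2 * E := by
      have h4 : T ^ 2 / (2 * γ) = (T ^ 2 / γ) / 2 := by field_simp
      rw [h4] at h1
      linarith
    exact this
  have hAn : 0 ≤ A := by rw [hAeq]; positivity
  refine ⟨?_, ?_⟩
  · -- strictness
    rcases (mul_nonneg hε hEn).eq_or_lt with hεE | hεE
    · -- `ε E = 0`: `g` is a plain forward field (`S g ≡ 0` or `ε = 0`)
      have hplain : ∀ x, (pinnedChain ω₂ lam β γ).generator L T T g x = -(kin L 0 x - T) := by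
        rcases mul_eq_zero.1 hεE.symm with h0 | h0
        · intro x; have h := hpde x
          rw [OscillatorChain.flipGenerator_eq_add_flipNoise, h0, zero_mul, add_zero] at h
          exact h
        · -- `E = 0`: every `g ∘ F_i − g` vanishes
          have hzero : ∀ i x, g (momentumFlip i x) - g x = 0 := by
            intro i
            have hgi : MemLp (fun x => g (momentumFlip i x)) 2 μ := memLp_comp_momentumFlip hflip hgL i
            have hint : Integrable (fun x => (g (momentumFlip i x) - g x) ^ 2) μ := (hgi.sub hgL).integrable_sq
            have hEi : ∫ x, (g (momentumFlip i x) - g x) ^ 2 ∂μ = 0 := by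
              have hle : ∫ x, (g (momentumFlip i x) - g x) ^ 2 ∂μ ≤ E := by
                rw [hE]
                exact Finset.single_le_sum (f := fun j => ∫ x, (g (momentumFlip j x) - g x) ^ 2 ∂μ)
                  (fun j _ => integral_nonneg fun x => sq_nonneg _) (Finset.mem_univ i)
              have hge : 0 ≤ ∫ x, (g (momentumFlip i x) - g x) ^ 2 ∂μ := integral_nonneg fun x => sq_nonneg _
              linarith
            have hae : (fun x => (g (momentumFlip i x) - g x) ^ 2) =ᵐ[μ] 0 :=
              (integral_eq_zero_iff_of_nonneg (fun x => sq_nonneg _) hint).1 hEi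
            -- transfer to Lebesgue-a.e. and then to everywhere by continuity
            have hcont : Continuous fun x => (g (momentumFlip i x) - g x) ^ 2 :=
              ((hg2.continuous.comp (continuous_momentumFlip i)).sub hg2.continuous).pow 2
            have hvol : (fun x => (g (momentumFlip i x) - g x) ^ 2) =ᵐ[volume] 0 := by
              have hρ : Integrable ((pinnedChain ω₂ lam β γ).gibbsDensity L T) := pinnedChain_integrable_gibbsDensity hω hl.le hβ.le γ L hT
              have hac : (volume : Measure (PhaseSpace L)) ≪ μ := by
                rw [hμ, OscillatorChain.gibbsMeasure_eq]
                exact absolutelyContinuous_tilted hρ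
              exact hac.ae_le hae
            have heq := (hcont.ae_eq_iff_eq volume continuous_const).1 hvol
            intro x
            have h2 : (g (momentumFlip i x) - g x) ^ 2 = 0 := congr_fun heq x
            exact pow_eq_zero_iff (n := 2) (by norm_num) |>.1 h2
          have hS0 : ∀ x, flipNoise L g x = 0 := fun x => by
            rw [flipNoise_eq]; exact Finset.sum_eq_zero fun i _ => hzero i x
          intro x; have h := hpde x
          rw [OscillatorChain.flipGenerator_eq_add_flipNoise, hS0 x, mul_zero, add_zero] at h
          exact h
      -- subtract the mean and apply `plainKubo_pos`
      set m : ℝ := ∫ x, g x ∂μ with hm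
      have hmem : (fun x => g x - m) ∈ plainForwardFields ω₂ lam β γ T L := by
        refine ⟨hg2.sub contDiff_const, hgL.sub (memLp_const m), ?_, fun x => ?_⟩
        · show ∫ x, (g x - m) ∂μ = 0
          rw [integral_sub (hgL.integrable one_le_two) (integrable_const m), integral_const, probReal_univ,
            one_smul, hm, sub_self]
        · rw [generator_sub_const]; exact hplain x
      have hpos := plainKubo_pos ω₂ lam β γ T hω hl hβ hγ hT L hL _ hmem
      have hint_eq : ∫ x, (g x - m) * (kin L 0 x - T) ∂μ = A := by
        have hk : Integrable (fun x => kin L 0 x - T) μ := by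
          have := hk0L2.integrable one_le_two
          exact this.congr (ae_of_all _ fun x => by simp [hkin x])
        have hk0 : ∫ x, (kin L 0 x - T) ∂μ = 0 := by
          have e : (fun x => kin L 0 x - T) = fun x => x.2 i0 ^ 2 - T := funext fun x => by rw [hkin x]
          rw [e, integral_sub hpL2.integrable_sq (integrable_const T), hp2, integral_const, probReal_univ, one_smul,
            sub_self]
        have i1 : Integrable (fun x => g x * (kin L 0 x - T)) μ :=
          (hgL.integrable_mul hk0L2).congr (ae_of_all _ fun x => by simp [hkin x])
        have e : (fun x => (g x - m) * (kin L 0 x - T)) = fun x => g x * (kin L 0 x - T) - m * (kin L 0 x - T) := by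
          funext x; ring
        rw [e, integral_sub i1 (hk.const_mul m), integral_const_mul, hk0, mul_zero, sub_zero]
      simp only [plainKubo] at hpos
      rw [hint_eq] at hpos
      exact hpos
    · -- `ε E > 0`: strict inequality `A < T²/γ`
      have hAlt : A < T ^ 2 / γ := by
        have : 0 ≤ γ * T * D1 := by positivity
        have hεE' : 0 < ε / 2 * E := by linarith
        linarith
      have h1 : γ / T ^ 2 * A < 1 := by
        rw [div_mul_eq_mul_div, div_lt_one (by positivity)]
        calc γ * A < γ * (T ^ 2 / γ) := mul_lt_mul_of_pos_left hAlt hγ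
          _ = T ^ 2 := by field_simp
      nlinarith
  · have h1 : 0 ≤ γ / T ^ 2 * A := by positivity
    nlinarith

end Positivity

/-! ## Registered helper -/

/-- Registered helper sub-goal `helper_flipKuboPositive` of stub `stub_noisyPositiveConductance` (line
`fekete-usc-one-length`, crux stmt-AtomisticToContinuum-11976): for every classical `C² ∩ L²(μ_T)` forward field
`g` of the flip-noisy equilibrium generator, `(L_{T,T} + εS) g = −(p_0² − T)` (`ε ≥ 0`, `L ≥ 2`), the Kubo
conductance `G = γ(1 − (γ/T²)⟨g, p_0² − T⟩_{μ_T})` satisfies `0 < G ≤ γ`, and the energy row sum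
`⟨g, p_0² − T⟩ + ⟨g, p_{L−1}² − T⟩ = T²/γ` holds (`flipKubo_pos_and_le`, `flip_rowSum`). -/
theorem helper_flipKuboPositive : ∀ (ω₂ lam β γ T ε : ℝ), 0 < ω₂ → 0 < lam → 0 < β → 0 < γ → 0 < T → 0 ≤ ε → ∀ (L : ℕ), 2 ≤ L → ∀ g : Literature.MathematicalPhysics.KineticTheory.HeatConduction.PhaseSpace L → ℝ, ContDiff ℝ 2 g → MeasureTheory.MemLp g 2 ((Literature.MathematicalPhysics.KineticTheory.HeatConduction.pinnedChain ω₂ lam β γ).gibbsMeasure L T) → (∀ x, (Literature.MathematicalPhysics.KineticTheory.HeatConduction.pinnedChain ω₂ lam β γ).flipGenerator L T T ε g x = -(Summit.AtomisticToContinuum.FouriersLaw.Theorems.SuperadditiveResistance.DeviceLiouville.kin L 0 x - T)) → (0 < γ * (1 - γ / T ^ 2 * MeasureTheory.integral ((Literature.MathematicalPhysics.KineticTheory.HeatConduction.pinnedChain ω₂ lam β γ).gibbsMeasure L T) (fun x => g x * (Summit.AtomisticToContinuum.FouriersLaw.Theorems.SuperadditiveResistance.DeviceLiouville.kin L 0 x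 - T))) ∧ γ * (1 - γ / T ^ 2 * MeasureTheory.integral ((Literature.MathematicalPhysics.KineticTheory.HeatConduction.pinnedChain ω₂ lam β γ).gibbsMeasure L T) (fun x => g x * (Summit.AtomisticToContinuum.FouriersLaw.Theorems.SuperadditiveResistance.DeviceLiouville.kin L 0 x - T))) ≤ γ) ∧ MeasureTheory.integral ((Literature.MathematicalPhysics.KineticTheory.HeatConduction.pinnedChain ω₂ lam β γ).gibbsMeasure L T) (fun x => g x * (Summit.AtomisticToContinuum.FouriersLaw.Theorems.SuperadditiveResistance.DeviceLiouville.kin L 0 x - T)) + MeasureTheory.integral ((Literature.MathematicalPhysics.KineticTheory.HeatConduction.pinnedChain ω₂ lam β γ).gibbsMeasure L T) (fun x => g x * (Summit.AtomisticToContinuum.FouriersLaw.Theorems.SuperadditiveResistance.DeviceLiouville.kin L (L - 1) x - T)) = T ^ 2 / γ :=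
  fun _ _ _ _ _ ε hω hl hβ hγ hT hε _ hL _ hg2 hgL hpde =>
    ⟨flipKubo_pos_and_le hω hl hβ hγ hT hε hL hg2 hgL hpde, flip_rowSum hω hl hβ hγ hT ε hL hg2 hgL hpde⟩


end Summit.AtomisticToContinuum.FouriersLaw.Theorems.VanishingNoiseBound

end
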